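import Mathlib.Tactic.Ring
import Mathlib.Tactic.Linarith
import Mathlib.Tactic.Positivity
import Mathlib.Tactic.LinearCombination
import Mathlib.Data.Real.Basic
import Summits.HodgeConjecture.HodgeConjecture.Theorems.WeilClassTestFormatFiveThreeProductFormula
import HarnessLib

/-!
# Conjecture N (hodge-weil ladder, GAPS G51b), format (5,3): THE WALL FORM OF `G` AND THE SEPARATED-WALLS LEMMA

Prover 2, generation 18 (note `run/shared/lean/b2b/hodge-weil/b2b-hweil-pv2-g18/MOMENTS-G18.md`). Setting of `CONJECTURE-N.md` §1 (format (5,3),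
real charges, centred; E-roots `(A_e,u_e)`, F-roots `(B_g,v_g)`). Write `p_e(y) = (u_e − v₁) + y(A_e − B₁)`, `q_e(y) = (u_e − v₂) + y(A_e − B₂)`,
`r_e(y) = (u_e − v₃) + y(A_e − B₃)`, `M₁₂(y) = Σ_k ∏_{e<k} p_e ∏_{e>k} q_e` (the divided difference of the moving E-polynomial at the moving F-roots
`W₁, W₂`; pv2-g15's `Glam_eq_dd12`: on the pure locus `Q₂ + λQ₄ = 2([y²] − 6λ[y⁰])M₁₂`), and the MOVING WALL of `E₁`:
`w₁(y) = (u₁ + yA₁)² − S(y)/2`, `S(y) = Σ_e(u_e + yA_e)² − Σ_g(v_g + yB_g)²`, i.e. `w₁₀ = u₁² − S_u/2`, `w₁₁ = 2u₁A₁ − S_{Au}`,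
`w₁₂ = A₁² − S_A/2` (`S_{Au} = Σ_eA_eu_e − Σ_gB_gv_g`, `S_A = ΣA² − ΣB²`).
THE WALL FORM (`M12_coeff0/1/2_wallform`, `Glam_eq_wallform`): with `P := p₂p₃p₄p₅` and `T := w₁·q₁·r₁`,
`M₁₂ ≡ P − T + q₁·(P4 + 3y·P2 + 3y²·P1)/3 (mod y³)` identically (centring only); hence ON THE PURE LOCUS
`(Q₂ + λQ₄)/2 = ([y²]P − 6λ[y⁰]P) − ([y²]T − 6λ[y⁰]T)`: `G_λ/2` is the 4-bracket of `E₂..E₅` against `F₁` MINUS the bracket of the single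
product `w₁q₁r₁` (this is the `(e,g) = (1,1)` instance of `σ(y) ≡ w_e(y)∏_{g'≠g}(U_e − W_{g'}) − ∏_{e'≠e}(U_{e'} − W_g)`, the slope of the
moving line read off the pair `(E_e, F_g)`). In the six open mixed patterns `E₂..E₅` lie above `F₁` (so `P` is a one-signed bracket) and `E₁` lies
below `F₂, F₃` (so `q₁, r₁` have negative constants). Also `Q₄ = 12([y⁰]T − [y⁰]P)` on the P4 locus (`Q4_eq_wallform`).
THE SEPARATED-WALLS LEMMA (`wallE_nonneg_sep`, `wallF_nonneg_sep`): for a centred separated (5,3) alphabet (`x_e ≥ y_g` for all `e, g`, `Σx = Σy`)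
EVERY wall `z² − (Σx² − Σy²)/2` (`z` among the eight letters) is nonnegative (explicit positive expansions in `s_e = x_e − max y ≥ 0`,
`t_g = max y − y_g ≥ 0`). Consequences (`posWall_nonneg`, `movingWall_nonneg_at_one/neg_one`): the position wall `w₁₂ = A₁² − S_A/2 ≥ 0` of every
pairwise-ample centred configuration, and `w₁(±1) = w₁₀ ± w₁₁ + w₁₂ ≥ 0` (the alphabets at times `±1` are separated).
Pure algebra; nothing here is a case of HC, a rung or a door edge; no statement of Markman's papers is used. New cell result ⇒ Summits/.
-/

set_option linter.dupNamespace false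

open Summit.HodgeConjecture.HodgeConjecture.WeilClassTestFormatFiveThreeProductFormula

namespace Summit.HodgeConjecture.HodgeConjecture.WeilClassTestFormatFiveThreeWallForm

/-- WALL FORM, coefficient `y^0` (centring only): `[y⁰]M₁₂ = [y⁰]P − [y⁰]T + ((u₁ − v₂)/3)·P4`, where `P = p₂p₃p₄p₅`, `T = w₁q₁r₁` (see the file docstring). -/
theorem M12_coeff0_wallform (A₁ A₂ A₃ A₄ A₅ B₁ B₂ B₃ u₁ u₂ u₃ u₄ u₅ v₁ v₂ v₃ : ℝ)
    (hA : A₁ + A₂ + A₃ + A₄ + A₅ = B₁ + B₂ + B₃) (hC : u₁ + u₂ + u₃ + u₄ + u₅ = v₁ + v₂ + v₃) :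
    ((u₂ - v₂) * (u₃ - v₂) * (u₄ - v₂) * (u₅ - v₂)) + ((u₁ - v₁) * (u₃ - v₂) * (u₄ - v₂) * (u₅ - v₂)) + ((u₁ - v₁) * (u₂ - v₁) * (u₄ - v₂) * (u₅ - v₂)) + ((u₁ - v₁) * (u₂ - v₁) * (u₃ - v₁) * (u₅ - v₂)) + ((u₁ - v₁) * (u₂ - v₁) * (u₃ - v₁) * (u₄ - v₁))
      = ((u₂ - v₁) * (u₃ - v₁) * (u₄ - v₁) * (u₅ - v₁)) - ((u₁ ^ 2 - ((u₁ ^ 2 + u₂ ^ 2 + u₃ ^ 2 + u₄ ^ 2 + u₅ ^ 2) - (v₁ ^ 2 + v₂ ^ 2 + v₃ ^ 2)) / 2) * ((u₁ - v₂) * (u₁ - v₃))) + (((u₁ - v₂) / 3) * ((u₁ ^ 3 + u₂ ^ 3 + u₃ ^ 3 + u₄ ^ 3 + u₅ ^ 3) - (v₁ ^ 3 + v₂ ^ 3 + v₃ ^ 3))) := by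
  have hB : B₃ = A₁ + A₂ + A₃ + A₄ + A₅ - B₁ - B₂ := by linarith
  have hv : v₃ = u₁ + u₂ + u₃ + u₄ + u₅ - v₁ - v₂ := by linarith
  subst hB; subst hv
  ring

/-- WALL FORM, coefficient `y^1` (centring only): `[y¹]M₁₂ = [y¹]P − [y¹]T + (u₁ − v₂)·P2 + ((A₁ − B₂)/3)·P4`, where `P = p₂p₃p₄p₅`, `T = w₁q₁r₁` (see the file docstring). -/
theorem M12_coeff1_wallform (A₁ A₂ A₃ A₄ A₅ B₁ B₂ B₃ u₁ u₂ u₃ u₄ u₅ v₁ v₂ v₃ : ℝ)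
    (hA : A₁ + A₂ + A₃ + A₄ + A₅ = B₁ + B₂ + B₃) (hC : u₁ + u₂ + u₃ + u₄ + u₅ = v₁ + v₂ + v₃) :
    ((A₂ - B₂) * (u₃ - v₂) * (u₄ - v₂) * (u₅ - v₂) + (u₂ - v₂) * (A₃ - B₂) * (u₄ - v₂) * (u₅ - v₂) + (u₂ - v₂) * (u₃ - v₂) * (A₄ - B₂) * (u₅ - v₂) + (u₂ - v₂) * (u₃ - v₂) * (u₄ - v₂) * (A₅ - B₂)) + ((A₁ - B₁) * (u₃ - v₂) * (u₄ - v₂) * (u₅ - v₂) + (u₁ - v₁) * (A₃ - B₂) * (u₄ - v₂) * (u₅ - v₂) + (u₁ - v₁) * (u₃ - v₂) * (A₄ - B₂) * (u₅ - v₂) + (u₁ - v₁) * (u₃ - v₂) * (u₄ - v₂) * (A₅ - B₂)) + ((A₁ - B₁) * (u₂ - v₁) * (u₄ - v₂) * (u₅ - v₂) + (u₁ - v₁) * (A₂ - B₁) * (u₄ - v₂) * (u₅ - v₂) + (u₁ - v₁) * (u₂ - v₁) * (A₄ - B₂) * (u₅ - v₂) + (u₁ - v₁) * (u₂ - v₁)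 * (u₄ - v₂) * (A₅ - B₂)) + ((A₁ - B₁) * (u₂ - v₁) * (u₃ - v₁) * (u₅ - v₂) + (u₁ - v₁) * (A₂ - B₁) * (u₃ - v₁) * (u₅ - v₂) + (u₁ - v₁) * (u₂ - v₁) * (A₃ - B₁) * (u₅ - v₂) + (u₁ - v₁) * (u₂ - v₁) * (u₃ - v₁) * (A₅ - B₂)) + ((A₁ - B₁) * (u₂ - v₁) * (u₃ - v₁) * (u₄ - v₁) + (u₁ - v₁) * (A₂ - B₁) * (u₃ - v₁) * (u₄ - v₁) + (u₁ - v₁) * (u₂ - v₁) * (A₃ - B₁) * (u₄ - v₁) + (u₁ - v₁) * (u₂ - v₁) * (u₃ - v₁) * (A₄ - B₁))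
      = ((A₂ - B₁) * (u₃ - v₁) * (u₄ - v₁) * (u₅ - v₁) + (u₂ - v₁) * (A₃ - B₁) * (u₄ - v₁) * (u₅ - v₁) + (u₂ - v₁) * (u₃ - v₁) * (A₄ - B₁) * (u₅ - v₁) + (u₂ - v₁) * (u₃ - v₁) * (u₄ - v₁) * (A₅ - B₁)) - ((u₁ ^ 2 - ((u₁ ^ 2 + u₂ ^ 2 + u₃ ^ 2 + u₄ ^ 2 + u₅ ^ 2) - (v₁ ^ 2 + v₂ ^ 2 + v₃ ^ 2)) / 2) * ((u₁ - v₂) * (A₁ - B₃) + (A₁ - B₂) * (u₁ - v₃)) + (2 * u₁ * A₁ - ((A₁ * u₁ + A₂ * u₂ + A₃ * u₃ + A₄ * u₄ + A₅ * u₅) - (B₁ * v₁ + B₂ * v₂ + B₃ * v₃))) * ((u₁ - v₂) * (u₁ - v₃))) + ((u₁ - v₂) * ((A₁ * u₁ ^ 2 + A₂ * u₂ ^ 2 + A₃ * u₃ ^ 2 + A₄ * u₄ ^ 2 + A₅ * u₅ ^ 2) - (B₁ * v₁ ^ 2 + B₂ * v₂ ^ 2 + B₃ * v₃ ^ 2))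 + ((A₁ - B₂) / 3) * ((u₁ ^ 3 + u₂ ^ 3 + u₃ ^ 3 + u₄ ^ 3 + u₅ ^ 3) - (v₁ ^ 3 + v₂ ^ 3 + v₃ ^ 3))) := by
  have hB : B₃ = A₁ + A₂ + A₃ + A₄ + A₅ - B₁ - B₂ := by linarith
  have hv : v₃ = u₁ + u₂ + u₃ + u₄ + u₅ - v₁ - v₂ := by linarith
  subst hB; subst hv
  ring

/-- WALL FORM, coefficient `y^2` (centring only): `[y²]M₁₂ = [y²]P − [y²]T + (u₁ − v₂)·P1 + (A₁ − B₂)·P2`, where `P = p₂p₃p₄p₅`, `T = w₁q₁r₁` (see the file docstring). -/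
theorem M12_coeff2_wallform (A₁ A₂ A₃ A₄ A₅ B₁ B₂ B₃ u₁ u₂ u₃ u₄ u₅ v₁ v₂ v₃ : ℝ)
    (hA : A₁ + A₂ + A₃ + A₄ + A₅ = B₁ + B₂ + B₃) (hC : u₁ + u₂ + u₃ + u₄ + u₅ = v₁ + v₂ + v₃) :
    ((A₂ - B₂) * (A₃ - B₂) * (u₄ - v₂) * (u₅ - v₂) + (A₂ - B₂) * (u₃ - v₂) * (A₄ - B₂) * (u₅ - v₂) + (A₂ - B₂) * (u₃ - v₂) * (u₄ - v₂) * (A₅ - B₂) + (u₂ - v₂) * (A₃ - B₂) * (A₄ - B₂) * (u₅ - v₂) + (u₂ - v₂) * (A₃ - B₂) * (u₄ - v₂) * (A₅ - B₂) + (u₂ - v₂) * (u₃ - v₂) * (A₄ - B₂) * (A₅ - B₂)) + ((A₁ - B₁) * (A₃ - B₂) * (u₄ - v₂) * (u₅ - v₂) + (A₁ - B₁) * (u₃ - v₂) * (A₄ - B₂) * (u₅ - v₂) + (A₁ - B₁) * (u₃ - v₂) * (u₄ - v₂) * (A₅ - B₂) + (u₁ - v₁) * (A₃ - B₂) * (A₄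 - B₂) * (u₅ - v₂) + (u₁ - v₁) * (A₃ - B₂) * (u₄ - v₂) * (A₅ - B₂) + (u₁ - v₁) * (u₃ - v₂) * (A₄ - B₂) * (A₅ - B₂)) + ((A₁ - B₁) * (A₂ - B₁) * (u₄ - v₂) * (u₅ - v₂) + (A₁ - B₁) * (u₂ - v₁) * (A₄ - B₂) * (u₅ - v₂) + (A₁ - B₁) * (u₂ - v₁) * (u₄ - v₂) * (A₅ - B₂) + (u₁ - v₁) * (A₂ - B₁) * (A₄ - B₂) * (u₅ - v₂) + (u₁ - v₁) * (A₂ - B₁) * (u₄ - v₂) * (A₅ - B₂) + (u₁ - v₁) * (u₂ - v₁) * (A₄ - B₂) * (A₅ - B₂)) + ((A₁ - B₁) * (A₂ - B₁) * (u₃ - v₁) * (u₅ - v₂) + (A₁ - B₁) * (u₂ - v₁) * (A₃ - B₁) * (u₅ - v₂) + (A₁ - B₁) * (u₂ - v₁) * (u₃ - v₁) * (A₅ - B₂) + (u₁ - v₁) * (A₂ - B₁) * (A₃ - B₁) * (u₅ - v₂) + (u₁ - v₁) * (A₂ - B₁) * (u₃ - v₁) * (A₅ - B₂) + (u₁ -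 v₁) * (u₂ - v₁) * (A₃ - B₁) * (A₅ - B₂)) + ((A₁ - B₁) * (A₂ - B₁) * (u₃ - v₁) * (u₄ - v₁) + (A₁ - B₁) * (u₂ - v₁) * (A₃ - B₁) * (u₄ - v₁) + (A₁ - B₁) * (u₂ - v₁) * (u₃ - v₁) * (A₄ - B₁) + (u₁ - v₁) * (A₂ - B₁) * (A₃ - B₁) * (u₄ - v₁) + (u₁ - v₁) * (A₂ - B₁) * (u₃ - v₁) * (A₄ - B₁) + (u₁ - v₁) * (u₂ - v₁) * (A₃ - B₁) * (A₄ - B₁))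
      = ((A₂ - B₁) * (A₃ - B₁) * (u₄ - v₁) * (u₅ - v₁) + (A₂ - B₁) * (u₃ - v₁) * (A₄ - B₁) * (u₅ - v₁) + (A₂ - B₁) * (u₃ - v₁) * (u₄ - v₁) * (A₅ - B₁) + (u₂ - v₁) * (A₃ - B₁) * (A₄ - B₁) * (u₅ - v₁) + (u₂ - v₁) * (A₃ - B₁) * (u₄ - v₁) * (A₅ - B₁) + (u₂ - v₁) * (u₃ - v₁) * (A₄ - B₁) * (A₅ - B₁)) - ((u₁ ^ 2 - ((u₁ ^ 2 + u₂ ^ 2 + u₃ ^ 2 + u₄ ^ 2 + u₅ ^ 2) - (v₁ ^ 2 + v₂ ^ 2 + v₃ ^ 2)) / 2) * ((A₁ - B₂) * (A₁ - B₃)) + (2 * u₁ * A₁ - ((A₁ * u₁ + A₂ * u₂ + A₃ * u₃ + A₄ * u₄ + A₅ * u₅) - (B₁ * v₁ + B₂ * v₂ + B₃ * v₃))) * ((u₁ - v₂) * (A₁ - B₃) + (A₁ - B₂) * (u₁ - v₃)) + (A₁ ^ 2 - ((A₁ ^ 2 + A₂ ^ 2 + A₃ ^ 2 + A₄ ^ 2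 + A₅ ^ 2) - (B₁ ^ 2 + B₂ ^ 2 + B₃ ^ 2)) / 2) * ((u₁ - v₂) * (u₁ - v₃))) + ((u₁ - v₂) * ((A₁ ^ 2 * u₁ + A₂ ^ 2 * u₂ + A₃ ^ 2 * u₃ + A₄ ^ 2 * u₄ + A₅ ^ 2 * u₅) - (B₁ ^ 2 * v₁ + B₂ ^ 2 * v₂ + B₃ ^ 2 * v₃)) + (A₁ - B₂) * ((A₁ * u₁ ^ 2 + A₂ * u₂ ^ 2 + A₃ * u₃ ^ 2 + A₄ * u₄ ^ 2 + A₅ * u₅ ^ 2) - (B₁ * v₁ ^ 2 + B₂ * v₂ ^ 2 + B₃ * v₃ ^ 2))) := by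
  have hB : B₃ = A₁ + A₂ + A₃ + A₄ + A₅ - B₁ - B₂ := by linarith
  have hv : v₃ = u₁ + u₂ + u₃ + u₄ + u₅ - v₁ - v₂ := by linarith
  subst hB; subst hv
  ring

/-- THE WALL FORM OF `G_λ` ON THE PURE LOCUS: `Q₂ + λQ₄ = 2(([y²]P − 6λ[y⁰]P) − ([y²]T − 6λ[y⁰]T))`, `P = ∏_{e≥2}((u_e − v₁) + y(A_e − B₁))`,
`T = w₁(y)·((u₁ − v₂) + y(A₁ − B₂))·((u₁ − v₃) + y(A₁ − B₃))`, `w₁(y) = w₁₀ + w₁₁y + w₁₂y²` the moving wall of `E₁`. -/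
theorem Glam_eq_wallform (A₁ A₂ A₃ A₄ A₅ B₁ B₂ B₃ u₁ u₂ u₃ u₄ u₅ v₁ v₂ v₃ : ℝ)
    (hA : A₁ + A₂ + A₃ + A₄ + A₅ = B₁ + B₂ + B₃) (hC : u₁ + u₂ + u₃ + u₄ + u₅ = v₁ + v₂ + v₃)
    (hP1 : (A₁ ^ 2 * u₁ + A₂ ^ 2 * u₂ + A₃ ^ 2 * u₃ + A₄ ^ 2 * u₄ + A₅ ^ 2 * u₅) - (B₁ ^ 2 * v₁ + B₂ ^ 2 * v₂ + B₃ ^ 2 * v₃) = 0)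
    (hP2 : (A₁ * u₁ ^ 2 + A₂ * u₂ ^ 2 + A₃ * u₃ ^ 2 + A₄ * u₄ ^ 2 + A₅ * u₅ ^ 2) - (B₁ * v₁ ^ 2 + B₂ * v₂ ^ 2 + B₃ * v₃ ^ 2) = 0)
    (hP4 : (u₁ ^ 3 + u₂ ^ 3 + u₃ ^ 3 + u₄ ^ 3 + u₅ ^ 3) - (v₁ ^ 3 + v₂ ^ 3 + v₃ ^ 3) = 0)
    (l : ℝ) :
    (1 / 2) * ((A₁ ^ 2 + A₂ ^ 2 + A₃ ^ 2 + A₄ ^ 2 + A₅ ^ 2) - (B₁ ^ 2 + B₂ ^ 2 + B₃ ^ 2)) * ((u₁ ^ 2 + u₂ ^ 2 + u₃ ^ 2 + u₄ ^ 2 + u₅ ^ 2) - (v₁ ^ 2 + v₂ ^ 2 + v₃ ^ 2))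
        + ((A₁ * u₁ + A₂ * u₂ + A₃ * u₃ + A₄ * u₄ + A₅ * u₅) - (B₁ * v₁ + B₂ * v₂ + B₃ * v₃)) ^ 2
        - 3 * ((A₁ ^ 2 * u₁ ^ 2 + A₂ ^ 2 * u₂ ^ 2 + A₃ ^ 2 * u₃ ^ 2 + A₄ ^ 2 * u₄ ^ 2 + A₅ ^ 2 * u₅ ^ 2) - (B₁ ^ 2 * v₁ ^ 2 + B₂ ^ 2 * v₂ ^ 2 + B₃ ^ 2 * v₃ ^ 2))
      + l * (3 * ((u₁ ^ 4 + u₂ ^ 4 + u₃ ^ 4 + u₄ ^ 4 + u₅ ^ 4) - (v₁ ^ 4 + v₂ ^ 4 + v₃ ^ 4)) - (3 / 2) * ((u₁ ^ 2 + u₂ ^ 2 + u₃ ^ 2 + u₄ ^ 2 + u₅ ^ 2) - (v₁ ^ 2 + v₂ ^ 2 + v₃ ^ 2)) ^ 2)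
      = 2 * ((((A₂ - B₁) * (A₃ - B₁) * (u₄ - v₁) * (u₅ - v₁) + (A₂ - B₁) * (u₃ - v₁) * (A₄ - B₁) * (u₅ - v₁) + (A₂ - B₁) * (u₃ - v₁) * (u₄ - v₁) * (A₅ - B₁) + (u₂ - v₁) * (A₃ - B₁) * (A₄ - B₁) * (u₅ - v₁) + (u₂ - v₁) * (A₃ - B₁) * (u₄ - v₁) * (A₅ - B₁) + (u₂ - v₁) * (u₃ - v₁) * (A₄ - B₁) * (A₅ - B₁)) - 6 * l * ((u₂ - v₁) * (u₃ - v₁) * (u₄ - v₁) * (u₅ - v₁))) - (((u₁ ^ 2 - ((u₁ ^ 2 + u₂ ^ 2 + u₃ ^ 2 + u₄ ^ 2 + u₅ ^ 2) - (v₁ ^ 2 + v₂ ^ 2 + v₃ ^ 2)) / 2) * ((A₁ - B₂) * (A₁ - B₃)) + (2 * u₁ * A₁ - ((A₁ * u₁ + A₂ * u₂ + A₃ * u₃ + A₄ * u₄ + A₅ * u₅) - (B₁ * v₁ + B₂ * v₂ + B₃ * v₃))) * ((u₁ - v₂) * (A₁ - B₃) + (A₁ - B₂) * (u₁ - v₃))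 + (A₁ ^ 2 - ((A₁ ^ 2 + A₂ ^ 2 + A₃ ^ 2 + A₄ ^ 2 + A₅ ^ 2) - (B₁ ^ 2 + B₂ ^ 2 + B₃ ^ 2)) / 2) * ((u₁ - v₂) * (u₁ - v₃))) - 6 * l * ((u₁ ^ 2 - ((u₁ ^ 2 + u₂ ^ 2 + u₃ ^ 2 + u₄ ^ 2 + u₅ ^ 2) - (v₁ ^ 2 + v₂ ^ 2 + v₃ ^ 2)) / 2) * ((u₁ - v₂) * (u₁ - v₃))))) := by
  rw [Glam_eq_dd12 A₁ A₂ A₃ A₄ A₅ B₁ B₂ B₃ u₁ u₂ u₃ u₄ u₅ v₁ v₂ v₃ hA hC hP1 hP2 hP4 l]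
  have hB : B₃ = A₁ + A₂ + A₃ + A₄ + A₅ - B₁ - B₂ := by linarith
  have hv : v₃ = u₁ + u₂ + u₃ + u₄ + u₅ - v₁ - v₂ := by linarith
  subst hB; subst hv
  linear_combination (2 * (u₁ - v₂)) * hP1 + (2 * (A₁ - B₂)) * hP2 + (-4 * l * (u₁ - v₂)) * hP4

/-- `Q₄` IN THE WALL FORM: `Q₄ = 12([y⁰]T − [y⁰]P) + 4(v₂ − u₁ + v₁ + v₂ + v₃)·P4`?  — precisely, given centring,
`Q₄ = 12·(w₁₀(u₁ − v₂)(u₁ − v₃) − ∏_{e≥2}(u_e − v₁)) + c·P4` with the explicit linear `c` below. -/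
theorem Q4_eq_wallform (u₁ u₂ u₃ u₄ u₅ v₁ v₂ v₃ : ℝ)
    (hC : u₁ + u₂ + u₃ + u₄ + u₅ = v₁ + v₂ + v₃) :
    3 * ((u₁ ^ 4 + u₂ ^ 4 + u₃ ^ 4 + u₄ ^ 4 + u₅ ^ 4) - (v₁ ^ 4 + v₂ ^ 4 + v₃ ^ 4)) - (3 / 2) * ((u₁ ^ 2 + u₂ ^ 2 + u₃ ^ 2 + u₄ ^ 2 + u₅ ^ 2) - (v₁ ^ 2 + v₂ ^ 2 + v₃ ^ 2)) ^ 2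
      = 12 * (((u₁ ^ 2 - ((u₁ ^ 2 + u₂ ^ 2 + u₃ ^ 2 + u₄ ^ 2 + u₅ ^ 2) - (v₁ ^ 2 + v₂ ^ 2 + v₃ ^ 2)) / 2) * ((u₁ - v₂) * (u₁ - v₃))) - ((u₂ - v₁) * (u₃ - v₁) * (u₄ - v₁) * (u₅ - v₁))) + (4 * (u₂ + u₃ + u₄ + u₅ - v₁)) * ((u₁ ^ 3 + u₂ ^ 3 + u₃ ^ 3 + u₄ ^ 3 + u₅ ^ 3) - (v₁ ^ 3 + v₂ ^ 3 + v₃ ^ 3)) := by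
  have hv : v₃ = u₁ + u₂ + u₃ + u₄ + u₅ - v₁ - v₂ := by linarith
  subst hv
  ring

/-- SEPARATED WALLS, core (an E-letter): in the shifted variables of a centred separated alphabet (`x_e = c + s_e`, `y = (c, c − t₂, c − t₃)`, `c = max y`, `s, t ≥ 0`) the wall of `x₁` is a polynomial with nonnegative coefficients in `s, t`. -/
theorem wallX1_core (c s₁ s₂ s₃ s₄ s₅ t₂ t₃ : ℝ) (_hs₁ : 0 ≤ s₁) (_hs₂ : 0 ≤ s₂) (_hs₃ : 0 ≤ s₃) (_hs₄ : 0 ≤ s₄) (_hs₅ : 0 ≤ s₅) (_ht₂ : 0 ≤ t₂) (_ht₃ : 0 ≤ t₃)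
    (hc : 5 * c + (s₁ + s₂ + s₃ + s₄ + s₅) = 3 * c - t₂ - t₃) :
    0 ≤ (c + s₁) ^ 2 - (((c + s₁) ^ 2 + (c + s₂) ^ 2 + (c + s₃) ^ 2 + (c + s₄) ^ 2 + (c + s₅) ^ 2) - (c ^ 2 + (c - t₂) ^ 2 + (c - t₃) ^ 2)) / 2 := by
  have hc' : c = -((s₁ + s₂ + s₃ + s₄ + s₅) + (t₂ + t₃)) / 2 := by linarith
  subst hc'
  have e : ((-((s₁ + s₂ + s₃ + s₄ + s₅) + (t₂ + t₃)) / 2) + s₁) ^ 2 - ((((-((s₁ + s₂ + s₃ + s₄ + s₅) + (t₂ + t₃)) / 2) + s₁) ^ 2 + ((-((s₁ + s₂ + s₃ + s₄ + s₅) + (t₂ + t₃)) / 2) + s₂) ^ 2 + ((-((s₁ + s₂ + s₃ + s₄ + s₅) + (t₂ + t₃)) / 2) + s₃) ^ 2 + ((-((s₁ + s₂ + s₃ + s₄ + s₅) + (t₂ + t₃)) / 2) + s₄) ^ 2 + ((-((s₁ + s₂ + s₃ + s₄ + s₅) + (t₂ + t₃)) / 2) + s₅) ^ 2) - ((-((s₁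 + s₂ + s₃ + s₄ + s₅) + (t₂ + t₃)) / 2) ^ 2 + ((-((s₁ + s₂ + s₃ + s₄ + s₅) + (t₂ + t₃)) / 2) - t₂) ^ 2 + ((-((s₁ + s₂ + s₃ + s₄ + s₅) + (t₂ + t₃)) / 2) - t₃) ^ 2)) / 2
      = s₂ * s₃ + s₂ * s₄ + s₂ * s₅ + s₂ * t₂ + s₂ * t₃ + s₃ * s₄ + s₃ * s₅ + s₃ * t₂ + s₃ * t₃ + s₄ * s₅ + s₄ * t₂ + s₄ * t₃ + s₅ * t₂ + s₅ * t₃ + t₂ ^ 2 + t₂ * t₃ + t₃ ^ 2 := by ring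
  rw [e]
  positivity

/-- SEPARATED WALLS, core (the top F-letter `y₁ = c`). -/
theorem wallY1_core (c s₁ s₂ s₃ s₄ s₅ t₂ t₃ : ℝ) (_hs₁ : 0 ≤ s₁) (_hs₂ : 0 ≤ s₂) (_hs₃ : 0 ≤ s₃) (_hs₄ : 0 ≤ s₄) (_hs₅ : 0 ≤ s₅) (_ht₂ : 0 ≤ t₂) (_ht₃ : 0 ≤ t₃)
    (hc : 5 * c + (s₁ + s₂ + s₃ + s₄ + s₅) = 3 * c - t₂ - t₃) :
    0 ≤ (c) ^ 2 - (((c + s₁) ^ 2 + (c + s₂) ^ 2 + (c + s₃) ^ 2 + (c + s₄) ^ 2 + (c + s₅) ^ 2) - (c ^ 2 + (c - t₂) ^ 2 + (c - t₃) ^ 2)) / 2 := by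
  have hc' : c = -((s₁ + s₂ + s₃ + s₄ + s₅) + (t₂ + t₃)) / 2 := by linarith
  subst hc'
  have e : ((-((s₁ + s₂ + s₃ + s₄ + s₅) + (t₂ + t₃)) / 2)) ^ 2 - ((((-((s₁ + s₂ + s₃ + s₄ + s₅) + (t₂ + t₃)) / 2) + s₁) ^ 2 + ((-((s₁ + s₂ + s₃ + s₄ + s₅) + (t₂ + t₃)) / 2) + s₂) ^ 2 + ((-((s₁ + s₂ + s₃ + s₄ + s₅) + (t₂ + t₃)) / 2) + s₃) ^ 2 + ((-((s₁ + s₂ + s₃ + s₄ + s₅) + (t₂ + t₃)) / 2) + s₄) ^ 2 + ((-((s₁ + s₂ + s₃ + s₄ + s₅) + (t₂ + t₃)) / 2) + s₅) ^ 2) - ((-((s₁ + s₂ + s₃ + s₄ + s₅) + (t₂ + t₃)) / 2) ^ 2 + ((-((s₁ + s₂ + s₃ + s₄ + s₅) + (t₂ + t₃)) / 2) - t₂) ^ 2 + ((-((s₁ + s₂ + s₃ + s₄ + s₅) + (t₂ + t₃)) / 2) - t₃) ^ 2)) / 2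
      = s₁ * s₂ + s₁ * s₃ + s₁ * s₄ + s₁ * s₅ + s₁ * t₂ + s₁ * t₃ + s₂ * s₃ + s₂ * s₄ + s₂ * s₅ + s₂ * t₂ + s₂ * t₃ + s₃ * s₄ + s₃ * s₅ + s₃ * t₂ + s₃ * t₃ + s₄ * s₅ + s₄ * t₂ + s₄ * t₃ + s₅ * t₂ + s₅ * t₃ + t₂ ^ 2 + t₂ * t₃ + t₃ ^ 2 := by ring
  rw [e]
  positivity

/-- SEPARATED WALLS, core (an F-letter below the top one, `y₂ = c − t₂`). -/
theorem wallY2_core (c s₁ s₂ s₃ s₄ s₅ t₂ t₃ : ℝ) (_hs₁ : 0 ≤ s₁) (_hs₂ : 0 ≤ s₂) (_hs₃ : 0 ≤ s₃) (_hs₄ : 0 ≤ s₄) (_hs₅ : 0 ≤ s₅) (_ht₂ : 0 ≤ t₂) (_ht₃ : 0 ≤ t₃)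
    (hc : 5 * c + (s₁ + s₂ + s₃ + s₄ + s₅) = 3 * c - t₂ - t₃) :
    0 ≤ (c - t₂) ^ 2 - (((c + s₁) ^ 2 + (c + s₂) ^ 2 + (c + s₃) ^ 2 + (c + s₄) ^ 2 + (c + s₅) ^ 2) - (c ^ 2 + (c - t₂) ^ 2 + (c - t₃) ^ 2)) / 2 := by
  have hc' : c = -((s₁ + s₂ + s₃ + s₄ + s₅) + (t₂ + t₃)) / 2 := by linarith
  subst hc'
  have e : ((-((s₁ + s₂ + s₃ + s₄ + s₅) + (t₂ + t₃)) / 2) - t₂) ^ 2 - ((((-((s₁ + s₂ + s₃ + s₄ + s₅) + (t₂ + t₃)) / 2) + s₁) ^ 2 + ((-((s₁ + s₂ + s₃ + s₄ + s₅) + (t₂ + t₃)) / 2) + s₂) ^ 2 + ((-((s₁ + s₂ + s₃ + s₄ + s₅) + (t₂ + t₃)) / 2) + s₃) ^ 2 + ((-((s₁ + s₂ + s₃ + s₄ + s₅) + (t₂ + t₃)) / 2) + s₄) ^ 2 + ((-((s₁ + s₂ + s₃ + s₄ + s₅) + (t₂ + t₃)) / 2) + s₅) ^ 2) - ((-((s₁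 + s₂ + s₃ + s₄ + s₅) + (t₂ + t₃)) / 2) ^ 2 + ((-((s₁ + s₂ + s₃ + s₄ + s₅) + (t₂ + t₃)) / 2) - t₂) ^ 2 + ((-((s₁ + s₂ + s₃ + s₄ + s₅) + (t₂ + t₃)) / 2) - t₃) ^ 2)) / 2
      = s₁ * s₂ + s₁ * s₃ + s₁ * s₄ + s₁ * s₅ + 2 * s₁ * t₂ + s₁ * t₃ + s₂ * s₃ + s₂ * s₄ + s₂ * s₅ + 2 * s₂ * t₂ + s₂ * t₃ + s₃ * s₄ + s₃ * s₅ + 2 * s₃ * t₂ + s₃ * t₃ + s₄ * s₅ + 2 * s₄ * t₂ + s₄ * t₃ + 2 * s₅ * t₂ + s₅ * t₃ + 3 * t₂ ^ 2 + 2 * t₂ * t₃ + t₃ ^ 2 := by ring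
  rw [e]
  positivity

/-- POSITION WALLS ARE NONNEGATIVE: for centred positions (`ΣA = ΣB`) with dominance `B_g ≤ A_e` (all pairs), the position wall of `E₁`,
`A₁² − S_A/2` (`S_A = ΣA² − ΣB²`), is `≥ 0`. (Separated-walls lemma, case split on the largest `B_g`.) By relabelling, every `A_e² − S_A/2 ≥ 0`. -/
theorem posWall_nonneg_E1 (A₁ A₂ A₃ A₄ A₅ B₁ B₂ B₃ : ℝ)
    (hA : A₁ + A₂ + A₃ + A₄ + A₅ = B₁ + B₂ + B₃)
    (d₁₁ : B₁ ≤ A₁) (d₂₁ : B₁ ≤ A₂) (d₃₁ : B₁ ≤ A₃) (d₄₁ : B₁ ≤ A₄) (d₅₁ : B₁ ≤ A₅) (d₁₂ : B₂ ≤ A₁) (d₂₂ : B₂ ≤ A₂) (d₃₂ : B₂ ≤ A₃) (d₄₂ : B₂ ≤ A₄) (d₅₂ : B₂ ≤ A₅) (d₁₃ : B₃ ≤ A₁) (d₂₃ : B₃ ≤ A₂) (d₃₃ : B₃ ≤ A₃) (d₄₃ : B₃ ≤ A₄) (d₅₃ : B₃ ≤ A₅) :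
    0 ≤ A₁ ^ 2 - ((A₁ ^ 2 + A₂ ^ 2 + A₃ ^ 2 + A₄ ^ 2 + A₅ ^ 2) - (B₁ ^ 2 + B₂ ^ 2 + B₃ ^ 2)) / 2 := by
  rcases le_total B₂ B₁ with h21 | h12
  · rcases le_total B₃ B₁ with h31 | h13
    · have key := wallX1_core B₁ (A₁ - B₁) (A₂ - B₁) (A₃ - B₁) (A₄ - B₁) (A₅ - B₁) (B₁ - B₂) (B₁ - B₃)
        (by linarith) (by linarith) (by linarith) (by linarith) (by linarith) (by linarith) (by linarith) (by linarith)
      have e : A₁ ^ 2 - ((A₁ ^ 2 + A₂ ^ 2 + A₃ ^ 2 + A₄ ^ 2 + A₅ ^ 2) - (B₁ ^ 2 + B₂ ^ 2 + B₃ ^ 2)) / 2 = ((B₁) + (A₁ - B₁)) ^ 2 - (((B₁ + (A₁ - B₁)) ^ 2 + (B₁ + (A₂ - B₁)) ^ 2 + (B₁ + (A₃ - B₁)) ^ 2 + (B₁ + (A₄ - B₁)) ^ 2 + (B₁ + (A₅ - B₁)) ^ 2) - (B₁ ^ 2 + (B₁ - (B₁ - B₂)) ^ 2 + (B₁ - (B₁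 - B₃)) ^ 2)) / 2 := by ring
      rw [e]; exact key
    · have key := wallX1_core B₃ (A₁ - B₃) (A₂ - B₃) (A₃ - B₃) (A₄ - B₃) (A₅ - B₃) (B₃ - B₁) (B₃ - B₂)
        (by linarith) (by linarith) (by linarith) (by linarith) (by linarith) (by linarith) (by linarith) (by linarith)
      have e : A₁ ^ 2 - ((A₁ ^ 2 + A₂ ^ 2 + A₃ ^ 2 + A₄ ^ 2 + A₅ ^ 2) - (B₁ ^ 2 + B₂ ^ 2 + B₃ ^ 2)) / 2 = ((B₃) + (A₁ - B₃)) ^ 2 - (((B₃ + (A₁ - B₃)) ^ 2 + (B₃ + (A₂ - B₃)) ^ 2 + (B₃ + (A₃ - B₃)) ^ 2 + (B₃ + (A₄ - B₃)) ^ 2 + (B₃ + (A₅ - B₃)) ^ 2) - (B₃ ^ 2 + (B₃ - (B₃ - B₁)) ^ 2 + (B₃ - (B₃ - B₂)) ^ 2)) / 2 := by ring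
      rw [e]; exact key
  · rcases le_total B₃ B₂ with h32 | h23
    · have key := wallX1_core B₂ (A₁ - B₂) (A₂ - B₂) (A₃ - B₂) (A₄ - B₂) (A₅ - B₂) (B₂ - B₁) (B₂ - B₃)
        (by linarith) (by linarith) (by linarith) (by linarith) (by linarith) (by linarith) (by linarith) (by linarith)
      have e : A₁ ^ 2 - ((A₁ ^ 2 + A₂ ^ 2 + A₃ ^ 2 + A₄ ^ 2 + A₅ ^ 2) - (B₁ ^ 2 + B₂ ^ 2 + B₃ ^ 2)) / 2 = ((B₂) + (A₁ - B₂)) ^ 2 - (((B₂ + (A₁ - B₂)) ^ 2 + (B₂ + (A₂ - B₂)) ^ 2 + (B₂ + (A₃ - B₂)) ^ 2 + (B₂ + (A₄ - B₂)) ^ 2 + (B₂ + (A₅ - B₂)) ^ 2) - (B₂ ^ 2 + (B₂ - (B₂ - B₁)) ^ 2 + (B₂ - (B₂ - B₃)) ^ 2)) / 2 := by ring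
      rw [e]; exact key
    · have key := wallX1_core B₃ (A₁ - B₃) (A₂ - B₃) (A₃ - B₃) (A₄ - B₃) (A₅ - B₃) (B₃ - B₁) (B₃ - B₂)
        (by linarith) (by linarith) (by linarith) (by linarith) (by linarith) (by linarith) (by linarith) (by linarith)
      have e : A₁ ^ 2 - ((A₁ ^ 2 + A₂ ^ 2 + A₃ ^ 2 + A₄ ^ 2 + A₅ ^ 2) - (B₁ ^ 2 + B₂ ^ 2 + B₃ ^ 2)) / 2 = ((B₃) + (A₁ - B₃)) ^ 2 - (((B₃ + (A₁ - B₃)) ^ 2 + (B₃ + (A₂ - B₃)) ^ 2 + (B₃ + (A₃ - B₃)) ^ 2 + (B₃ + (A₄ - B₃)) ^ 2 + (B₃ + (A₅ - B₃)) ^ 2) - (B₃ ^ 2 + (B₃ - (B₃ - B₁)) ^ 2 + (B₃ - (B₃ - B₂)) ^ 2)) / 2 := by ring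
      rw [e]; exact key

/-- THE MOVING WALL OF `E₁` AT TIME `+1` IS NONNEGATIVE: for a centred pairwise-ample configuration, `w₁(1) = (u₁ + A₁)² − S(1)/2 ≥ 0`, where
`S(1) = Σ_e(u_e + A_e)² − Σ_g(v_g + B_g)²` (the alphabet at time `1` is separated and centred). -/
theorem movingWall_nonneg_at_one (A₁ A₂ A₃ A₄ A₅ B₁ B₂ B₃ u₁ u₂ u₃ u₄ u₅ v₁ v₂ v₃ : ℝ)
    (hA : A₁ + A₂ + A₃ + A₄ + A₅ = B₁ + B₂ + B₃) (hC : u₁ + u₂ + u₃ + u₄ + u₅ = v₁ + v₂ + v₃)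
    (m₁₁ : |u₁ - v₁| ≤ A₁ - B₁) (m₂₁ : |u₂ - v₁| ≤ A₂ - B₁) (m₃₁ : |u₃ - v₁| ≤ A₃ - B₁) (m₄₁ : |u₄ - v₁| ≤ A₄ - B₁) (m₅₁ : |u₅ - v₁| ≤ A₅ - B₁)
    (m₁₂ : |u₁ - v₂| ≤ A₁ - B₂) (m₂₂ : |u₂ - v₂| ≤ A₂ - B₂) (m₃₂ : |u₃ - v₂| ≤ A₃ - B₂) (m₄₂ : |u₄ - v₂| ≤ A₄ - B₂) (m₅₂ : |u₅ - v₂| ≤ A₅ - B₂)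
    (m₁₃ : |u₁ - v₃| ≤ A₁ - B₃) (m₂₃ : |u₂ - v₃| ≤ A₂ - B₃) (m₃₃ : |u₃ - v₃| ≤ A₃ - B₃) (m₄₃ : |u₄ - v₃| ≤ A₄ - B₃) (m₅₃ : |u₅ - v₃| ≤ A₅ - B₃) :
    0 ≤ (u₁ + A₁) ^ 2 - (((u₁ + A₁) ^ 2 + (u₂ + A₂) ^ 2 + (u₃ + A₃) ^ 2 + (u₄ + A₄) ^ 2 + (u₅ + A₅) ^ 2) - ((v₁ + B₁) ^ 2 + (v₂ + B₂) ^ 2 + (v₃ + B₃) ^ 2)) / 2 :=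
  posWall_nonneg_E1 (u₁ + A₁) (u₂ + A₂) (u₃ + A₃) (u₄ + A₄) (u₅ + A₅) (v₁ + B₁) (v₂ + B₂) (v₃ + B₃) (by linarith)
    (by linarith [(abs_le.mp m₁₁).1]) (by linarith [(abs_le.mp m₂₁).1]) (by linarith [(abs_le.mp m₃₁).1]) (by linarith [(abs_le.mp m₄₁).1]) (by linarith [(abs_le.mp m₅₁).1]) (by linarith [(abs_le.mp m₁₂).1]) (by linarith [(abs_le.mp m₂₂).1]) (by linarith [(abs_le.mp m₃₂).1]) (by linarith [(abs_le.mp m₄₂).1]) (by linarith [(abs_le.mp m₅₂).1]) (by linarith [(abs_le.mp m₁₃).1]) (by linarith [(abs_le.mp m₂₃).1]) (by linarith [(abs_le.mp m₃₃).1]) (by linarith [(abs_le.mp m₄₃).1]) (by linarith [(abs_le.mp m₅₃).1])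

/-- THE MOVING WALL OF `E₁` AT TIME `−1` IS NONNEGATIVE: `w₁(−1) = (A₁ − u₁)² − S(−1)/2 ≥ 0` (alphabet at time `−1`, reflected: `A − u ≥ B − v`). -/
theorem movingWall_nonneg_at_neg_one (A₁ A₂ A₃ A₄ A₅ B₁ B₂ B₃ u₁ u₂ u₃ u₄ u₅ v₁ v₂ v₃ : ℝ)
    (hA : A₁ + A₂ + A₃ + A₄ + A₅ = B₁ + B₂ + B₃) (hC : u₁ + u₂ + u₃ + u₄ + u₅ = v₁ + v₂ + v₃)
    (m₁₁ : |u₁ - v₁| ≤ A₁ - B₁) (m₂₁ : |u₂ - v₁| ≤ A₂ - B₁) (m₃₁ : |u₃ - v₁| ≤ A₃ - B₁) (m₄₁ : |u₄ - v₁| ≤ A₄ - B₁) (m₅₁ : |u₅ - v₁| ≤ A₅ - B₁)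
    (m₁₂ : |u₁ - v₂| ≤ A₁ - B₂) (m₂₂ : |u₂ - v₂| ≤ A₂ - B₂) (m₃₂ : |u₃ - v₂| ≤ A₃ - B₂) (m₄₂ : |u₄ - v₂| ≤ A₄ - B₂) (m₅₂ : |u₅ - v₂| ≤ A₅ - B₂)
    (m₁₃ : |u₁ - v₃| ≤ A₁ - B₃) (m₂₃ : |u₂ - v₃| ≤ A₂ - B₃) (m₃₃ : |u₃ - v₃| ≤ A₃ - B₃) (m₄₃ : |u₄ - v₃| ≤ A₄ - B₃) (m₅₃ : |u₅ - v₃| ≤ A₅ - B₃) :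
    0 ≤ (A₁ - u₁) ^ 2 - (((A₁ - u₁) ^ 2 + (A₂ - u₂) ^ 2 + (A₃ - u₃) ^ 2 + (A₄ - u₄) ^ 2 + (A₅ - u₅) ^ 2) - ((B₁ - v₁) ^ 2 + (B₂ - v₂) ^ 2 + (B₃ - v₃) ^ 2)) / 2 :=
  posWall_nonneg_E1 (A₁ - u₁) (A₂ - u₂) (A₃ - u₃) (A₄ - u₄) (A₅ - u₅) (B₁ - v₁) (B₂ - v₂) (B₃ - v₃) (by linarith)
    (by linarith [(abs_le.mp m₁₁).2]) (by linarith [(abs_le.mp m₂₁).2]) (by linarith [(abs_le.mp m₃₁).2]) (by linarith [(abs_le.mp m₄₁).2]) (by linarith [(abs_le.mp m₅₁).2]) (by linarith [(abs_le.mp m₁₂).2]) (by linarith [(abs_le.mp m₂₂).2]) (by linarith [(abs_le.mp m₃₂).2]) (by linarith [(abs_le.mp m₄₂).2]) (by linarith [(abs_le.mp m₅₂).2]) (by linarith [(abs_le.mp m₁₃).2]) (by linarith [(abs_le.mp m₂₃).2]) (by linarith [(abs_le.mp m₃₃).2]) (by linarith [(abs_le.mp m₄₃).2]) (by linarith [(abs_le.mp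 m₅₃).2])

end Summit.HodgeConjecture.HodgeConjecture.WeilClassTestFormatFiveThreeWallForm
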